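import Summits.ValiantsHypothesis.ValiantsHypothesis.Theorems.VPBoundarySquareUniformCover
import HarnessLib

/-!
# VP-boundary square — the Q-side hypothesis in finite-level form: uniform debordering

The hypothesis of the route item `Q := EmptyBoundarySeparates` (and the conclusion of
`P := CollapseEmptiesBoundary`) is the family statement

  `A :  every p-family with p-bounded border complexity is p-computable`   (`∂VP = ∅`).

By the same compactness move as `uniformCHCover_of_chClosureDefinable` (diagonal over the
COUNTABLY many exponents `e`), `A` is equivalent to a statement about the finite-dimensional border
sets alone — the **debordering overhead** at fixed budget is eventually polynomial:

  `UniformDebordering d :  ∃ e N, ∀ n ≥ N, every border point g of budget d at level n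
                           (u, deg g, \underline{L}(g) ≤ n^d + d) has L(g) ≤ n^e + e`,

`boundaryEmpty_iff_uniformDebordering : A ↔ ∀ d, UniformDebordering d`.  Consequently the [GCT5]
question `closure(VP) ∩ p-fam ⊄ VP` (`BoundaryOfVPNonempty`, route item `M`) reads
«some budget `d` has superpolynomial debordering overhead at infinitely many levels»
(`boundaryOfVPNonempty_iff_exists_not_uniformDebordering`, `not_uniformDebordering_iff`), and the
route items read `Q ↔ ((∀ d, UniformDebordering d) → VNP ⊄ closure(VP))`,
`P ↔ (VP = VNP → ∀ d, UniformDebordering d)`.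

The only debordering bounds in print for general circuits are exponential in the budget-level
parameters (order of approximation `2^{poly}`), so `UniformDebordering d` is open for every `d ≥ 1`;
it is a theorem in the sibling models whose complexity is a flattening rank (noncommutative ABP width,
`BDI2020_cor_6_7_zariski` in the tree).

References: Bürgisser–Landsberg–Manivel–Weyman 2011, Def. 9.3.1 (border complexity);
Grochow–Mulmuley–Qiao 2016, §1 (the question `closure(VP) = VP`?); Bürgisser 2000, Def. 2.1
(p-bounded); Bläser–Dörfler–Ikenmeyer 2020, Cor. 13 (ncABP width is closed).
-/

noncomputable section

set_option linter.dupNamespace false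

open Literature.Computability.AlgebraicComplexity Literature.Computability.Complexity

open Summit.ValiantsHypothesis.ValiantsHypothesis.Theses.VPBoundarySquare
open Summit.ValiantsHypothesis.ValiantsHypothesis.Theorems.VPBoundarySquareUniformCover

namespace Summit.ValiantsHypothesis.ValiantsHypothesis.Theorems.VPBoundarySquareUniformDebordering

/-- **Uniform debordering at budget `d`**: one exponent `e` bounds, at all large levels, the
circuit complexity of EVERY border point of budget `d`. [cite: BurgisserEtAl2011, Def. 9.3.1] -/
def UniformDebordering (d : ℕ) : Prop :=
  ∃ e N : ℕ, ∀ n, N ≤ n → ∀ (u : ℕ) (g : MvPolynomial (Fin u) ℂ),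
    IsBorderPoint d n g → complexity g ≤ n ^ e + e

/-- The escape form of `¬ UniformDebordering d`: for every exponent, border points of budget `d`
needing larger circuits occur at levels beyond any bound. [cite: BurgisserEtAl2011, Def. 9.3.1] -/
theorem not_uniformDebordering_iff (d : ℕ) :
    ¬ UniformDebordering d ↔ ∀ e N : ℕ, ∃ n, N ≤ n ∧ ∃ (u : ℕ) (g : MvPolynomial (Fin u) ℂ),
      IsBorderPoint d n g ∧ n ^ e + e < complexity g := by
  simp [UniformDebordering]

/-- **(⇐) finite levels ⟹ families**: uniform debordering at every budget empties the boundary of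
`VP` on p-families (levels below the threshold contribute a constant). [cite: Burgisser2000, Def. 2.1(1)] -/
theorem boundaryEmpty_of_uniformDebordering (h : ∀ d, UniformDebordering d) :
    ∀ (v : ℕ → ℕ) (f : ∀ n, MvPolynomial (Fin (v n)) ℂ), IsPFamily f → IsVPBarFamily f →
      IsPComputable f := by
  classical
  intro v f hPF hBar
  obtain ⟨d, hd⟩ := IsPBounded.add_holds (IsPBounded.add_holds hPF.1 hPF.2) hBar
  have hbp : ∀ n, IsBorderPoint d n (f n) := by
    intro n
    have h := hd n
    simp only [Fintype.card_fin] at h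
    exact ⟨by omega, by omega, by omega⟩
  obtain ⟨e, N, hN⟩ := h d
  -- the finitely many levels below `N` are bounded by a constant
  let M : ℕ := (Finset.range N).sup fun n => complexity (f n)
  have hM : ∀ n, n < N → complexity (f n) ≤ M :=
    fun n hn => Finset.le_sup (f := fun n => complexity (f n)) (Finset.mem_range.2 hn)
  have hpb : IsPBounded fun n => M + (n ^ e + e) :=
    IsPBounded.add_holds (IsPBounded.const M) ⟨e, fun n => le_rfl⟩
  refine hpb.mono fun n => ?_
  by_cases hn : N ≤ n
  · exact (hN n hn (v n) (f n) (hbp n)).trans (Nat.le_add_left _ _)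
  · exact (hM n (not_le.1 hn)).trans (Nat.le_add_right _ _)

/-- **(⇒) families ⟹ finite levels**, by diagonalisation over the countably many exponents: if some
budget `d` is not uniformly debordered, select pairwise distinct escape levels `n_e` carrying border
points `g_e` of budget `d` with `L(g_e) > n_e^e + e`; padded by `0` they form a `\overline{VP}`
p-family, which `∂VP = ∅` makes p-computable with some exponent `e₀` — contradiction at `n_{e₀}`.
[cite: BurgisserEtAl2011, §9.3 (closure of VP)] [cite: Burgisser2000, Def. 2.1(1)] -/
theorem uniformDebordering_of_boundaryEmpty
    (hA : ∀ (v : ℕ → ℕ) (f : ∀ n, MvPolynomial (Fin (v n)) ℂ), IsPFamily f → IsVPBarFamily f →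
      IsPComputable f) (d : ℕ) : UniformDebordering d := by
  classical
  by_contra hneg
  have hEsc : ∀ (e N : ℕ), ∃ n, N ≤ n ∧ ∃ (u : ℕ) (g : MvPolynomial (Fin u) ℂ),
      IsBorderPoint d n g ∧ n ^ e + e < complexity g := (not_uniformDebordering_iff d).1 hneg
  obtain ⟨lev, hinj, hlev⟩ := exists_injective_selection (D := ℕ) hEsc
  choose u g hbp hlt using hlev
  -- the diagonal family
  obtain ⟨pick, hpick_bp, hpick_eq⟩ : ∃ pick : ℕ → Σ u : ℕ, MvPolynomial (Fin u) ℂ,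
      (∀ n, IsBorderPoint d n (pick n).2) ∧ ∀ e, pick (lev e) = ⟨u e, g e⟩ := by
    refine ⟨fun n => if h : ∃ e, lev e = n then ⟨u h.choose, g h.choose⟩ else ⟨0, 0⟩, ?_, ?_⟩
    · intro n
      by_cases h : ∃ e, lev e = n
      · have key := hbp h.choose
        rw [h.choose_spec] at key
        beta_reduce
        rw [dif_pos h]
        exact key
      · beta_reduce
        rw [dif_neg h]
        exact isBorderPoint_zero d n
    · intro e
      have h : ∃ e', lev e' = lev e := ⟨e, rfl⟩
      have he : h.choose = e := hinj h.choose_spec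
      simp only [dif_pos h]
      rw [he]
  have hPF : IsPFamily (fun n => (pick n).2) :=
    ⟨⟨d, fun n => by simpa [Fintype.card_fin] using (hpick_bp n).1⟩, ⟨d, fun n => (hpick_bp n).2.1⟩⟩
  have hBar : IsVPBarFamily (fun n => (pick n).2) := ⟨d, fun n => (hpick_bp n).2.2⟩
  -- `∂VP = ∅` makes it p-computable with ONE exponent `e₀` …
  obtain ⟨e₀, he₀⟩ := hA (fun n => (pick n).1) (fun n => (pick n).2) hPF hBar
  -- … contradicted at the escape level chosen for `e₀`
  have key := he₀ (lev e₀)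
  have hlt₀ := hlt e₀
  simp only at key
  rw [hpick_eq e₀] at key
  exact absurd key (not_le.2 hlt₀)

/-- ★ **`∂VP = ∅` on p-families ⟺ uniform debordering at every budget.**
[cite: BurgisserEtAl2011, §9.3 (closure of VP)] [cite: GrochowMulmuleyQiao2016, §1] -/
theorem boundaryEmpty_iff_uniformDebordering :
    (∀ (v : ℕ → ℕ) (f : ∀ n, MvPolynomial (Fin (v n)) ℂ), IsPFamily f → IsVPBarFamily f →
      IsPComputable f) ↔ ∀ d, UniformDebordering d :=
  ⟨uniformDebordering_of_boundaryEmpty, boundaryEmpty_of_uniformDebordering⟩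

/-- **The [GCT5] question in finite-level form**: the boundary of `VP` contains a p-family iff SOME
budget has superpolynomial debordering overhead at infinitely many levels.
[cite: GrochowMulmuleyQiao2016, §1] -/
theorem boundaryOfVPNonempty_iff_exists_not_uniformDebordering :
    BoundaryOfVPNonempty ↔ ∃ d, ¬ UniformDebordering d := by
  rw [BoundaryOfVPNonempty, boundaryEmpty_iff_uniformDebordering, not_forall]

/-- The same, fully unfolded. [cite: GrochowMulmuleyQiao2016, §1] -/
theorem boundaryOfVPNonempty_iff_escape :
    BoundaryOfVPNonempty ↔ ∃ d, ∀ e N : ℕ, ∃ n, N ≤ n ∧ ∃ (u : ℕ) (g : MvPolynomial (Fin u) ℂ),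
      IsBorderPoint d n g ∧ n ^ e + e < complexity g := by
  rw [boundaryOfVPNonempty_iff_exists_not_uniformDebordering]
  exact exists_congr fun d => not_uniformDebordering_iff d

/-- **`Q` in finite-level form**: `EmptyBoundarySeparates ↔
((∀ d, UniformDebordering d) → VNP ⊄ closure(VP) on p-families)`. [cite: BurgisserEtAl2011, §9.3 (closure of VP)] -/
theorem emptyBoundarySeparates_iff_uniformDebordering :
    EmptyBoundarySeparates ↔ ((∀ d, UniformDebordering d) →
      ¬ ∀ (v : ℕ → ℕ) (f : ∀ n, MvPolynomial (Fin (v n)) ℂ), IsVNPFamily f → IsVPBarFamily f) := by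
  rw [EmptyBoundarySeparates, boundaryEmpty_iff_uniformDebordering]

/-- **`P` in finite-level form**: `CollapseEmptiesBoundary ↔ (VP = VNP → ∀ d, UniformDebordering d)`.
[cite: BurgisserEtAl2011, §9.3 (closure of VP)] -/
theorem collapseEmptiesBoundary_iff_uniformDebordering :
    CollapseEmptiesBoundary ↔ (VP ℂ = VNP ℂ → ∀ d, UniformDebordering d) := by
  rw [CollapseEmptiesBoundary, boundaryEmpty_iff_uniformDebordering]

/-- Monotonicity in the budget: a larger budget is harder to deborder. [cite: BurgisserEtAl2011, Def. 9.3.1] -/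
theorem UniformDebordering.anti {d d' : ℕ} (hdd' : d ≤ d') (h : UniformDebordering d') :
    UniformDebordering d := by
  obtain ⟨e, N, hN⟩ := h
  refine ⟨e, N + 1, fun n hn u g hg => hN n (Nat.le_of_succ_le hn) u g ?_⟩
  have hn1 : 1 ≤ n := le_trans (Nat.succ_le_succ (Nat.zero_le N)) hn
  have hmono : n ^ d + d ≤ n ^ d' + d' := Nat.add_le_add (Nat.pow_le_pow_right hn1 hdd') hdd'
  exact ⟨hg.1.trans hmono, hg.2.1.trans hmono, hg.2.2.trans hmono⟩

end Summit.ValiantsHypothesis.ValiantsHypothesis.Theorems.VPBoundarySquareUniformDebordering
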